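import Mathlib
import Summits.NavierStokesRegularity.NavierStokesRegularity.Theorems.FilamentSkeletonRssClause13BallPoincare

/-!
# Clause 13-J, brick B4/B8: POINCARÉ ON THE BALL for complex variations — `∫_a^b ‖Y‖² ≤ ((b−a)/π)² ∫_a^b ‖Y′‖²`

Route `FilamentSkeletonRss`, child `Clause13NearStraightL` (stmt-NavierStokesRegularity-23321; typing-agnostic).  The complex (`J`-reduced
normal bundle ≅ ℂ) form of `integral_sq_le_sq_mul_integral_deriv_sq` (p671202): for `Y : ℝ → ℂ` with derivative `Y′` on `(a, b)`, `Y`, `Y′`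
continuous on `[a, b]` and `Y(a) = Y(b) = 0`, `∫_a^b ‖Y‖² ≤ ((b−a)/π)²·∫_a^b ‖Y′‖²` (real and imaginary parts separately, then add).
This is the "Poincaré on the ball" input of `filament-plan/DESIGN-NOTE-28296-tenure-g22.md` §5 for ball-supported normal variations.
Lane ns-filament-19175-p1 g14; `--supports stmt-NavierStokesRegularity-23321 --as helper`.
HONEST FRAMING: an elementary inequality attached to a HYPOTHETICAL filament skeleton's linearised operator on the NEGATIVE side of a
MODEL route; nothing here bears on Navier–Stokes regularity or blow-up.
-/

noncomputable section

open MeasureTheory Real Set intervalIntegral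

namespace Summit.NavierStokesRegularity.NavierStokesRegularity.Theorems.MatchedKernel
set_option linter.dupNamespace false

/-- `d/dx Re Y = Re Y′` for `Y : ℝ → ℂ`. [folklore] -/
theorem hasDerivAt_re_comp {Y : ℝ → ℂ} {Y' : ℂ} {x : ℝ} (h : HasDerivAt Y Y' x) :
    HasDerivAt (fun t => (Y t).re) Y'.re x := by
  have h2 : HasDerivAt (⇑Complex.reCLM ∘ Y) (Complex.reCLM Y') x := (Complex.reCLM.hasFDerivAt (x := Y x)).comp_hasDerivAt x h
  exact h2

/-- `d/dx Im Y = Im Y′` for `Y : ℝ → ℂ`. [folklore] -/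
theorem hasDerivAt_im_comp {Y : ℝ → ℂ} {Y' : ℂ} {x : ℝ} (h : HasDerivAt Y Y' x) :
    HasDerivAt (fun t => (Y t).im) Y'.im x := by
  have h2 : HasDerivAt (⇑Complex.imCLM ∘ Y) (Complex.imCLM Y') x := (Complex.imCLM.hasFDerivAt (x := Y x)).comp_hasDerivAt x h
  exact h2

/-- **Dirichlet–Poincaré on `[a, b]` for complex `Y` (sharp constant).** [folklore; Hardy–Littlewood–Pólya Thm 257 rescaled] -/
theorem integral_norm_sq_le_sq_mul_integral_norm_deriv_sq {Y Y' : ℝ → ℂ} {a b : ℝ} (hab : a < b)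
    (hY : ∀ x ∈ Ioo a b, HasDerivAt Y (Y' x) x) (hYc : ContinuousOn Y (Icc a b)) (hY'c : ContinuousOn Y' (Icc a b))
    (hYa : Y a = 0) (hYb : Y b = 0) :
    ∫ x in a..b, ‖Y x‖ ^ 2 ≤ ((b - a) / π) ^ 2 * ∫ x in a..b, ‖Y' x‖ ^ 2 := by
  -- real and imaginary parts
  have hre := integral_sq_le_sq_mul_integral_deriv_sq (F := fun t => (Y t).re) (f := fun t => (Y' t).re) hab
    (fun x hx => hasDerivAt_re_comp (hY x hx)) (Complex.continuous_re.comp_continuousOn hYc)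
    (Complex.continuous_re.comp_continuousOn hY'c) (by simp [hYa]) (by simp [hYb])
  have him := integral_sq_le_sq_mul_integral_deriv_sq (F := fun t => (Y t).im) (f := fun t => (Y' t).im) hab
    (fun x hx => hasDerivAt_im_comp (hY x hx)) (Complex.continuous_im.comp_continuousOn hYc)
    (Complex.continuous_im.comp_continuousOn hY'c) (by simp [hYa]) (by simp [hYb])
  have huI : uIcc a b = Icc a b := uIcc_of_le hab.le
  -- `‖z‖² = re² + im²`
  have hsplit : ∀ (Z : ℝ → ℂ), ContinuousOn Z (Icc a b) →
      ∫ x in a..b, ‖Z x‖ ^ 2 = (∫ x in a..b, (Z x).re ^ 2) + ∫ x in a..b, (Z x).im ^ 2 := by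
    intro Z hZ
    rw [← intervalIntegral.integral_add]
    · refine intervalIntegral.integral_congr fun x _ => ?_
      simp only [Complex.sq_norm, Complex.normSq_apply]; ring
    · exact (((Complex.continuous_re.comp_continuousOn hZ).pow 2).mono (by rw [huI])).intervalIntegrable
    · exact (((Complex.continuous_im.comp_continuousOn hZ).pow 2).mono (by rw [huI])).intervalIntegrable
  rw [hsplit Y hYc, hsplit Y' hY'c, mul_add]
  exact add_le_add hre him

end Summit.NavierStokesRegularity.NavierStokesRegularity.Theorems.MatchedKernel

end
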